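import Summits.Ventures.PercRepro.ProfileTwoAverage

/-!
# PercRepro — THE ROW `q = 3` OF (Π): THE INDEPENDENT HALF, WITH THE «`u−2` COLOOPS ⊕ LINE» SETS ADDED — the pieces
(p10, gen 5; `proofs/P10-Q3-INDEP.md` §1–§2; the step and the induction are in `ProfileThreeAverageStep`)

For a simple matroid `M` and a level `u ≥ 4`, the demand of the independent triples,
`Σ_{B ∈ I₃} d_B`, `d_B = [u ≤ ρ(E∖B)]·C(ρ(E∖B), u−3)` (`demand M 3 u B`), is at most `C(u,3)` times the number
of independent `u`-sets PLUS the number of rank-`u` sets with exactly `u−2` coloops (`fSets M u`: the sets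
`K ⊔ L`, `K` the `u−2` coloops, `L` a rank-2 set with `≥ 3` points).  The plain bound by the independent
`u`-sets alone is false (`U_{2,4} ⊕ U_{2,4}`, `u = 4`); the correction is exactly the set of complements of
the BAD triples — those with `ρ(E∖B) = u` and `u−2` coloops in `E∖B` — on which the per-triple inequality of the
averaged deletion step is short by exactly `C(u,3)`.

Proof (the induction of `ProfileTwoAverage`, with the deficit located and paid).  Induction on `|E|`.
`|E| ≤ u+2`: no demand; `|E| = u+3`: `d_B = C(u,3)·[E∖B independent]` and `B ↦ E∖B` injects into the
independent `u`-sets.  `|E| ≥ u+4`: per triple, `(|E|−u)·d_B ≤ Σ_{z∉B} d_{M∖z}(B)` unless `B` is bad (the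
arithmetic is `perPair_arith_core` at `a = u−4`; simplicity gives `κ ≤ u−2`, and `κ = u−2` is the bad case),
and a bad `B` is short by `C(u,3)` = one unit per bad triple.  Summing and applying the induction hypothesis to
the `|E|` simple deletions: `Σ_z I_u(M∖z) = (|E|−u)·I_u(M)` and `Σ_z F_u(M∖z) = Σ_{S∈F} (|E| − |S|) =
(|E|−u)·F_u(M) − Σ_{S∈F}(|S|−u)`, while `#Bad ≤ Σ_{S∈F}(|S|−u)` because `B ↦ E∖B` injects the bad triples into
the sets of `F` of size `|E|−3 ≥ u+1`.

* `fSets` — the rank-`u` dependent sets with exactly `u−2` coloops;  `badTriples` — the bad triples;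
* `sum_ite_erase3`, `perTriple_arith`, `perTriple`, `perTriple_bad` — the per-triple inequality;
* `fSets_delete_eq_filter`, `sum_card_fSets_delete` — the deletion identity of `F`;
* `card_badTriples_le` — the injection;
* the averaged step, the base levels and the induction are in `ProfileThreeAverageStep`
  (**`indep3Plus_of_simple`** — `INDEP₃⁺` on every simple matroid, every `u ≥ 4`).
-/

open scoped Matroid

namespace PercRepro.Cogirth

open Finset ThmH Skew Shadow Profile

variable {α : Type} [DecidableEq α] {M : Matroid α} [M.Finite]

/-! ### The sets of the correction term -/

open Classical in
/-- The rank-`u` DEPENDENT subsets of the ground set with exactly `u − 2` coloops (`= K ⊔ L`, `K` the coloops,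
`L` a rank-2 set with at least three points). -/
noncomputable def fSets (M : Matroid α) [M.Finite] (u : ℕ) : Finset (Finset α) :=
  (gr M).powerset.filter (fun S => rk M S = u ∧ u < S.card ∧ (coloops M S).card = u - 2)

open Classical in
/-- Membership in `fSets`. -/
theorem mem_fSets {u : ℕ} {S : Finset α} :
    S ∈ fSets M u ↔ S ⊆ gr M ∧ rk M S = u ∧ u < S.card ∧ (coloops M S).card = u - 2 := by
  unfold fSets
  rw [mem_filter, mem_powerset]

open Classical in
/-- The BAD triples: independent triples `B` with `ρ(E ∖ B) = u` and exactly `u − 2` coloops in `E ∖ B`. -/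
noncomputable def badTriples (M : Matroid α) [M.Finite] (u : ℕ) : Finset (Finset α) :=
  (indepSets M 3).filter (fun B => rk M (gr M \ B) = u ∧ (coloops M (gr M \ B)).card = u - 2)

open Classical in
/-- Membership in `badTriples`. -/
theorem mem_badTriples {u : ℕ} {B : Finset α} :
    B ∈ badTriples M u ↔ B ∈ indepSets M 3 ∧ rk M (gr M \ B) = u ∧ (coloops M (gr M \ B)).card = u - 2 := by
  unfold badTriples
  rw [mem_filter]

/-- **`INDEP₃⁺`** at level `u`: the demand of the independent triples is at most `C(u,3)` times the number of
independent `u`-sets plus the number of sets of `fSets`. -/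
def Indep3Plus (M : Matroid α) [M.Finite] (u : ℕ) : Prop :=
  ∑ B ∈ indepSets M 3, demand M 3 u B ≤ u.choose 3 * ((indepSets M u).card + (fSets M u).card)

/-! ### The demand of a triple and its deletions -/

/-- `demand M 3 u B = [u ≤ ρ(E ∖ B)] · C(ρ(E ∖ B), u − 3)`. -/
theorem demand3_eq_ite (u : ℕ) (B : Finset α) :
    demand M 3 u B = if u ≤ rk M (gr M \ B) then (rk M (gr M \ B)).choose (u - 3) else 0 := rfl

/-- The demand of a triple `B` in `M ∖ z` is read off the rank of `(E ∖ B) ∖ z` in `M`. -/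
theorem demand3_delete_eq_ite (u : ℕ) (B : Finset α) (z : α) :
    demand (M ＼ ({z} : Set α)) 3 u B =
      if u ≤ rk M ((gr M \ B).erase z) then (rk M ((gr M \ B).erase z)).choose (u - 3) else 0 := by
  unfold demand
  have hsub : (gr M \ B).erase z ⊆ (gr M).erase z := erase_subset_erase z sdiff_subset
  rw [gr_delete', erase_sdiff, rk_delete hsub]

/-- `Σ_{z ∈ X} d(ρ(X ∖ z)) = (|X| − κ) · d(ρ X) + κ · d(ρ X − 1)` for `d(r) = [u ≤ r] · C(r, u−3)`,
`κ := #coloops X` (the `q = 3` form of `sum_ite_erase`). -/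
theorem sum_ite_erase3 {X : Finset α} (hX : X ⊆ gr M) (u : ℕ) :
    ∑ z ∈ X, (if u ≤ rk M (X.erase z) then (rk M (X.erase z)).choose (u - 3) else 0) =
      (X.card - (coloops M X).card) * (if u ≤ rk M X then (rk M X).choose (u - 3) else 0) +
        (coloops M X).card * (if u ≤ rk M X - 1 then (rk M X - 1).choose (u - 3) else 0) := by
  have hKX : coloops M X ⊆ X := coloops_subset X
  rw [← sum_sdiff hKX]
  congr 1
  · rw [sum_congr rfl (fun z hz => by
        rw [rk_erase_of_notMem_coloops hX (sdiff_subset hz) (mem_sdiff.1 hz).2]),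
      sum_const, smul_eq_mul, card_sdiff_of_subset hKX]
  · rw [sum_congr rfl (fun z hz => by
        have h := rk_erase_of_mem_coloops hX hz
        rw [show rk M (X.erase z) = rk M X - 1 by omega]),
      sum_const, smul_eq_mul]

/-- The arithmetic of the per-triple inequality: `(n − u) · d(ρ) ≤ (n − 3 − κ) · d(ρ) + κ · d(ρ − 1)` for
`d(r) = [u ≤ r] · C(r, u−3)`, `κ ≤ ρ`, `κ ≤ u − 3` if `ρ = u`, `u ≥ 4`, `n ≥ u + 4`. -/
theorem perTriple_arith {u n r k : ℕ} (hu : 4 ≤ u) (hn : u + 4 ≤ n) (hkr : k ≤ r)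
    (hku : r = u → k ≤ u - 3) (hkn : k ≤ n - 3) :
    (n - u) * (if u ≤ r then r.choose (u - 3) else 0) ≤
      (n - 3 - k) * (if u ≤ r then r.choose (u - 3) else 0) +
        k * (if u ≤ r - 1 then (r - 1).choose (u - 3) else 0) := by
  rcases lt_trichotomy r u with hlt | heq | hgt
  · rw [if_neg (not_le.2 hlt), if_neg (by omega)]
    simp
  · subst heq
    rw [if_pos le_rfl, if_neg (by omega), mul_zero, add_zero]
    exact Nat.mul_le_mul_right _ (by have := hku rfl; omega)
  · rw [if_pos hgt.le, if_pos (by omega)]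
    obtain ⟨a, rfl⟩ : ∃ a, u = a + 4 := ⟨u - 4, by omega⟩
    obtain ⟨r', rfl⟩ : ∃ r', r = r' + 1 := ⟨r - 1, by omega⟩
    rw [show a + 4 - 3 = a + 1 by omega, Nat.add_sub_cancel, show n - (a + 4) = n - 3 - (a + 1) by omega]
    exact perPair_arith_core hkr hkn (by omega)

/-- The complement of an independent triple has `|E| − 3` elements. -/
theorem card_sdiff_of_mem_indepSets_three {B : Finset α} (hB : B ∈ indepSets M 3) :
    (gr M \ B).card = (gr M).card - 3 := by
  rw [mem_indepSets] at hB
  rw [card_sdiff_of_subset hB.1, hB.2.1]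

/-- **The per-triple inequality** for a triple that is NOT bad: `(|E| − u) · d_B ≤ Σ_{z ∈ E ∖ B} d_{M∖z}(B)`
(simple `M`, `u ≥ 4`, `|E| ≥ u + 4`). -/
theorem perTriple (hs : Simple' M) {u : ℕ} (hu : 4 ≤ u) (hn : u + 4 ≤ (gr M).card) {B : Finset α}
    (hB : B ∈ indepSets M 3) (hbad : B ∉ badTriples M u) :
    ((gr M).card - u) * demand M 3 u B ≤ ∑ z ∈ gr M \ B, demand (M ＼ ({z} : Set α)) 3 u B := by
  have hX : gr M \ B ⊆ gr M := sdiff_subset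
  have hXc : (gr M \ B).card = (gr M).card - 3 := card_sdiff_of_mem_indepSets_three hB
  rw [demand3_eq_ite, sum_congr rfl (fun z _ => demand3_delete_eq_ite u B z), sum_ite_erase3 hX u, hXc]
  apply perTriple_arith hu hn
  · exact card_coloops_le_rk hX
  · intro hr
    have h2 := card_coloops_le_of_rk_eq hs hX (by omega) hr (by omega)
    have hnb : (coloops M (gr M \ B)).card ≠ u - 2 := by
      intro h
      exact hbad (mem_badTriples.2 ⟨hB, hr, h⟩)
    omega
  · rw [← hXc]
    exact card_le_card (coloops_subset _)

/-- **The per-triple inequality for a BAD triple**: short by exactly `C(u,3)`: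
`(|E| − u) · d_B = Σ_{z ∈ E ∖ B} d_{M∖z}(B) + C(u,3)` (`u ≥ 4`, `|E| ≥ u + 4`). -/
theorem perTriple_bad {u : ℕ} (hu : 4 ≤ u) (hn : u + 4 ≤ (gr M).card) {B : Finset α}
    (hB : B ∈ badTriples M u) :
    ((gr M).card - u) * demand M 3 u B = ∑ z ∈ gr M \ B, demand (M ＼ ({z} : Set α)) 3 u B + u.choose 3 := by
  rw [mem_badTriples] at hB
  obtain ⟨hB, hr, hk⟩ := hB
  have hX : gr M \ B ⊆ gr M := sdiff_subset
  have hXc : (gr M \ B).card = (gr M).card - 3 := card_sdiff_of_mem_indepSets_three hB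
  rw [demand3_eq_ite, sum_congr rfl (fun z _ => demand3_delete_eq_ite u B z), sum_ite_erase3 hX u, hXc, hr, hk,
    if_pos le_rfl, if_neg (by omega), mul_zero, add_zero, Nat.choose_symm (by omega : 3 ≤ u)]
  have : (gr M).card - u = (gr M).card - 3 - (u - 2) + 1 := by omega
  rw [this, Nat.add_mul, one_mul]

/-! ### The deletion identity of `fSets` -/

/-- The coloops of a set avoiding `z` are the same in `M ∖ z` (the closure of a set avoiding `z` in `M ∖ z`
is its closure in `M` minus `z`). -/
theorem coloops_delete {S : Finset α} (z : α) (hz : z ∉ S) :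
    coloops (M ＼ ({z} : Set α)) S = coloops M S := by
  ext w
  rw [mem_coloops, mem_coloops]
  have hdisj : Disjoint ((S.erase w : Finset α) : Set α) ({z} : Set α) := by
    rw [Set.disjoint_singleton_right]
    intro hzS
    exact hz (erase_subset w S (by exact_mod_cast hzS))
  constructor
  · rintro ⟨hw, hcl⟩
    refine ⟨hw, fun h => hcl ?_⟩
    have h1 : w ∈ M.closure ((S.erase w : Finset α) : Set α) := by
      rw [← coe_clF]; exact_mod_cast h
    have h2 : w ∈ (M ＼ ({z} : Set α)).closure ((S.erase w : Finset α) : Set α) := by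
      rw [Matroid.delete_closure_eq_of_disjoint M hdisj]
      exact ⟨h1, fun hwz => hz (by rw [Set.mem_singleton_iff] at hwz; exact hwz ▸ hw)⟩
    rw [← coe_clF] at h2
    exact_mod_cast h2
  · rintro ⟨hw, hcl⟩
    refine ⟨hw, fun h => hcl ?_⟩
    have h2 : w ∈ (M ＼ ({z} : Set α)).closure ((S.erase w : Finset α) : Set α) := by
      rw [← coe_clF]; exact_mod_cast h
    rw [Matroid.delete_closure_eq_of_disjoint M hdisj] at h2
    have h1 : w ∈ M.closure ((S.erase w : Finset α) : Set α) := h2.1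
    rw [← coe_clF] at h1
    exact_mod_cast h1

/-- `fSets (M ∖ z) u` is the family of sets of `fSets M u` avoiding `z`. -/
theorem fSets_delete_eq_filter (z : α) (u : ℕ) :
    fSets (M ＼ ({z} : Set α)) u = (fSets M u).filter (fun S => z ∉ S) := by
  ext S
  rw [mem_filter, mem_fSets, mem_fSets, gr_delete']
  constructor
  · rintro ⟨hS, hr, hc, hk⟩
    have hzS : z ∉ S := fun h => (mem_erase.1 (hS h)).1 rfl
    rw [rk_delete hS] at hr
    rw [coloops_delete z hzS] at hk
    exact ⟨⟨hS.trans (erase_subset z _), hr, hc, hk⟩, hzS⟩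
  · rintro ⟨⟨hS, hr, hc, hk⟩, hzS⟩
    have hS' : S ⊆ (gr M).erase z := fun w hw => mem_erase.2 ⟨fun h => hzS (h ▸ hw), hS hw⟩
    refine ⟨hS', ?_, hc, ?_⟩
    · rw [rk_delete hS']; exact hr
    · rw [coloops_delete z hzS]; exact hk

/-- `Σ_{z ∈ E} F_u(M ∖ z) + Σ_{S ∈ F_u(M)} |S| = |E| · F_u(M)`: every set of `F_u` is counted once per element
outside it. -/
theorem sum_card_fSets_delete_add (u : ℕ) :
    ∑ z ∈ gr M, (fSets (M ＼ ({z} : Set α)) u).card + ∑ S ∈ fSets M u, S.card =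
      (gr M).card * (fSets M u).card := by
  have h1 : ∑ z ∈ gr M, (fSets (M ＼ ({z} : Set α)) u).card =
      ∑ S ∈ fSets M u, ((gr M).card - S.card) := by
    calc ∑ z ∈ gr M, (fSets (M ＼ ({z} : Set α)) u).card
        = ∑ z ∈ gr M, ((fSets M u).bipartiteAbove (fun z S => z ∉ S) z).card := by
          apply sum_congr rfl
          intro z _
          rw [fSets_delete_eq_filter]
          rfl
      _ = ∑ S ∈ fSets M u, ((gr M).bipartiteBelow (fun z S => z ∉ S) S).card :=
          sum_card_bipartiteAbove_eq_sum_card_bipartiteBelow _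
      _ = ∑ S ∈ fSets M u, ((gr M).card - S.card) := by
          apply sum_congr rfl
          intro S hS
          have hSg : S ⊆ gr M := (mem_fSets.1 hS).1
          rw [← card_sdiff_of_subset hSg]
          congr 1
          ext z
          rw [mem_bipartiteBelow, mem_sdiff]
  rw [h1, ← sum_add_distrib]
  rw [sum_congr rfl (fun S hS => Nat.sub_add_cancel (card_le_card (mem_fSets.1 hS).1))]
  rw [sum_const, smul_eq_mul, mul_comm]

/-! ### The injection of the bad triples -/

/-- The complement of a bad triple is a set of `fSets` of size `|E| − 3`. -/
theorem sdiff_mem_fSets_of_mem_badTriples {u : ℕ} (hn : u + 4 ≤ (gr M).card) {B : Finset α}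
    (hB : B ∈ badTriples M u) : gr M \ B ∈ fSets M u ∧ (gr M \ B).card = (gr M).card - 3 := by
  rw [mem_badTriples] at hB
  obtain ⟨hB, hr, hk⟩ := hB
  have hc := card_sdiff_of_mem_indepSets_three hB
  refine ⟨?_, hc⟩
  rw [mem_fSets]
  exact ⟨sdiff_subset, hr, by omega, hk⟩

/-- `#Bad ≤ Σ_{S ∈ F_u} (|S| − u)`: `B ↦ E ∖ B` injects the bad triples into the sets of `F_u` of size
`|E| − 3 ≥ u + 1`, each of which contributes at least one to the sum. -/
theorem card_badTriples_le {u : ℕ} (hn : u + 4 ≤ (gr M).card) :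
    (badTriples M u).card ≤ ∑ S ∈ fSets M u, (S.card - u) := by
  have hinj : (badTriples M u).card ≤ ((fSets M u).filter (fun S => S.card = (gr M).card - 3)).card := by
    apply card_le_card_of_injOn (fun B => gr M \ B)
    · intro B hB
      rw [Finset.mem_coe] at hB
      rw [Finset.mem_coe, mem_filter]
      exact sdiff_mem_fSets_of_mem_badTriples hn hB
    · intro B hB B' hB' h
      rw [Finset.mem_coe, mem_badTriples] at hB hB'
      have h1 : B ⊆ gr M := (mem_indepSets.1 hB.1).1
      have h2 : B' ⊆ gr M := (mem_indepSets.1 hB'.1).1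
      simp only at h
      rw [← Finset.sdiff_sdiff_eq_self h1, ← Finset.sdiff_sdiff_eq_self h2, h]
  calc (badTriples M u).card ≤ ((fSets M u).filter (fun S => S.card = (gr M).card - 3)).card := hinj
    _ ≤ ∑ S ∈ (fSets M u).filter (fun S => S.card = (gr M).card - 3), (S.card - u) := by
        rw [card_eq_sum_ones]
        apply sum_le_sum
        intro S hS
        rw [mem_filter] at hS
        omega
    _ ≤ ∑ S ∈ fSets M u, (S.card - u) :=
        sum_le_sum_of_subset_of_nonneg (filter_subset _ _) (fun _ _ _ => Nat.zero_le _)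

end PercRepro.Cogirth
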